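import Mathlib
import Literature.NumberTheory.LFunctions.PolynomialRootMoebiusSharpCutoff
import HarnessLib

/-!
# Landau's theorem for `∑ μ(n)ρ_g(n)/n` in sharp cut-off form with the de la Vallée-Poussin rate

Topic `Literature/NumberTheory/LFunctions` (sequel to `PolynomialRootMoebiusSharpCutoff.lean`, which proves the
log-power form `|M(x)| ≤ C/(log x)²` and remarks that "the same argument with `y = x(1 + e^{−(c/2)√log x})`
would give the de la Vallée-Poussin rate"; this file carries that remark out).  Everything here is PROVED;
no definitions, no named facts.

* `MoebiusRootCount.abs_cutoff_le_of_logRiesz_of_shortInterval` — the abstract differencing lemma: for a real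
  sequence `a` whose log-Riesz mean `R(x) = ∑_{n ≤ x} (a(n)/n) log(x/n)` satisfies `|R(x) − L| ≤ C e^{−c√log x}`
  (`x ≥ 1`) and whose short-interval mass is `∑_{x<n≤y} |a(n)| ≤ A₁(y − x) + A₂ y^θ` (`θ < 1`), the sharp
  cut-off `M(x) = ∑_{n ≤ x} a(n)/n` satisfies `|M(x)| ≤ (4C + A₁ + 2A₂K) e^{−(c/2)√log x}` for all `x ≥ 1`,
  `K = exp(c²/(16(1−θ)))`;
* `abs_sum_moebius_rootCount_div_le_exp` — for `g ∈ ℤ[X]` irreducible of positive degree there are `c > 0`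
  and `C` with `|∑_{n ≤ x} μ(n)ρ_g(n)/n| ≤ C·exp(−c√(log x))` for all real `x ≥ 1`
  (`ρ_g(n) = polyRootCountMod ![g] n`);
* `abs_sum_moebius_rootCount_div_le_log_pow` — hence, for every `A : ℕ`, `|∑_{n ≤ x} μ(n)ρ_g(n)/n| ≤ C_A/(log x)^A`
  for `x ≥ 2`.

## Proof

With `h = e^{−(c/2)√log x} ∈ (0, 1]`, `y = x(1 + h)` and `ℓ = log(y/x) ≥ h/(1+h) ≥ h/2`, the identity
`R(y) − R(x) = ℓ·M(x) + ∑_{x<n≤y}(a(n)/n)log(y/n)` (`MoebiusRootCount.logRieszSum_sub_eq`) and the tail bound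
`MoebiusRootCount.abs_tail_le` give `|M(x)| ≤ 2Ce^{−c√log x}/ℓ + A₁h + A₂y^θ/x ≤ 4Ch + A₁h + 2A₂x^{θ−1}`, and
`x^{θ−1} = e^{−(1−θ)log x} ≤ K e^{−(c/2)√log x}` because `(1−θ)t² − (c/2)t + c²/(16(1−θ)) = (1−θ)(t − c/(4(1−θ)))² ≥ 0`.
The log-power form uses `u^{2A} e^{−cu} ≤ (2A)!/c^{2A}` (`Real.pow_div_factorial_le_exp`).

## References

* E. Landau, *Neuer Beweis des Primzahlsatzes und Beweis des Primidealsatzes*, Math. Ann. 56 (1903),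
  645–670, Part II. [LandauMathAnn1903]
* H. L. Montgomery, R. C. Vaughan, *Multiplicative Number Theory I*, CUP 2007, §6.2 (6.17)–(6.19)
  (`∑_{n≤x} μ(n)/n ≪ exp(−c√log x)` by differencing the Riesz mean) and §8.4, Theorem 8.9.
  [MontgomeryVaughan2007]

## Mathlib / tree search

Tree: `abs_logRieszMean_moebius_rootCount_sub_le` (Riesz form, dlVP rate),
`MoebiusRootCount.shortInterval_abs_moebius_mul_rootCount_le`, `abs_sum_moebius_rootCount_div_le` (log-square
rate only; `lean search 'exp.*sqrt.*log|moebius_rootCount_div_le'`: no exponential-rate sharp cut-off existed).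
-/

noncomputable section

open Filter Finset Nat ArithmeticFunction Polynomial
open scoped Topology BigOperators ArithmeticFunction.Moebius

namespace Literature.NumberTheory.LFunctions

open Literature.NumberTheory.Sieve

namespace MoebiusRootCount

/-- `x^{θ-1} ≤ exp(c²/(16(1-θ))) · exp(-(c/2)√(log x))` for `x ≥ 1`, `θ < 1`: a power saving beats the
de la Vallée-Poussin rate up to an explicit constant (any real `c`). [folklore] -/
private theorem rpow_sub_one_le_exp_mul_exp {θ : ℝ} (c : ℝ) (hθ : θ < 1) {x : ℝ} (hx : 1 ≤ x) :
    x ^ (θ - 1) ≤ Real.exp (c ^ 2 / (16 * (1 - θ))) * Real.exp (-(c / 2) * Real.sqrt (Real.log x)) := by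
  have hx0 : 0 < x := by linarith
  have hl0 : 0 ≤ Real.log x := Real.log_nonneg hx
  set t : ℝ := Real.sqrt (Real.log x) with ht
  have ht2 : t ^ 2 = Real.log x := Real.sq_sqrt hl0
  rw [Real.rpow_def_of_pos hx0, ← Real.exp_add]
  refine Real.exp_le_exp.mpr ?_
  have h1θ : 0 < 1 - θ := by linarith
  have key : 0 ≤ (1 - θ) * (t - c / (4 * (1 - θ))) ^ 2 := by positivity
  have e : (1 - θ) * (t - c / (4 * (1 - θ))) ^ 2 =
      (1 - θ) * t ^ 2 - c / 2 * t + c ^ 2 / (16 * (1 - θ)) := by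
    field_simp
    ring
  rw [e, ht2] at key
  nlinarith [key]

/-- **From a log-Riesz mean with de la Vallée-Poussin rate and a short-interval bound to the sharp cut-off.**
If `|∑_{n≤x}(a(n)/n)log(x/n) − L| ≤ C e^{−c√log x}` for `x ≥ 1` and `∑_{x<n≤y}|a(n)| ≤ A₁(y−x) + A₂y^θ` for
`1 ≤ x ≤ y` (`θ < 1`), then `|∑_{n≤x} a(n)/n| ≤ (4C + A₁ + 2A₂e^{c²/(16(1−θ))})·e^{−(c/2)√log x}` for all
`x ≥ 1` (Montgomery–Vaughan §6.2, differencing over `[x, x(1 + e^{−(c/2)√log x})]`).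
[cite: MontgomeryVaughan2007, §6.2 (6.17)–(6.19)] -/
theorem abs_cutoff_le_of_logRiesz_of_shortInterval (a : ℕ → ℝ) {L c C A₁ A₂ θ : ℝ} (hc : 0 < c)
    (hC : 0 ≤ C) (hA₂ : 0 ≤ A₂) (hθ : θ < 1)
    (hR : ∀ x : ℝ, 1 ≤ x →
      |(∑ n ∈ Icc 1 ⌊x⌋₊, a n / n * Real.log (x / n)) - L| ≤
        C * Real.exp (-(c * Real.sqrt (Real.log x))))
    (hS : ∀ x y : ℝ, 1 ≤ x → x ≤ y → ∑ n ∈ Ioc ⌊x⌋₊ ⌊y⌋₊, |a n| ≤ A₁ * (y - x) + A₂ * y ^ θ) :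
    ∀ x : ℝ, 1 ≤ x →
      |∑ n ∈ Icc 1 ⌊x⌋₊, a n / n| ≤
        (4 * C + A₁ + 2 * A₂ * Real.exp (c ^ 2 / (16 * (1 - θ)))) *
          Real.exp (-(c / 2) * Real.sqrt (Real.log x)) := by
  intro x hx1
  set lx : ℝ := Real.log x with hlx
  have hx0 : 0 < x := by linarith
  have hlx0 : 0 ≤ lx := Real.log_nonneg hx1
  -- the parameters `E = e^{-c√lx}`, `h = e^{-(c/2)√lx}`, `E = h²`
  set E : ℝ := Real.exp (-(c * Real.sqrt lx)) with hE
  set h : ℝ := Real.exp (-(c / 2) * Real.sqrt lx) with hh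
  have hh0 : 0 < h := Real.exp_pos _
  have hh1 : h ≤ 1 := by
    rw [hh, ← Real.exp_zero]
    exact Real.exp_le_exp.mpr (by nlinarith [Real.sqrt_nonneg lx])
  have hEh : E = h * h := by
    rw [hE, hh, ← Real.exp_add]
    congr 1
    ring
  set y : ℝ := x * (1 + h) with hy
  have hxy : x ≤ y := by rw [hy]; nlinarith
  have hy0 : 0 < y := hx0.trans_le hxy
  have hyx : y / x = 1 + h := by rw [hy]; field_simp
  set ℓ : ℝ := Real.log (y / x) with hℓ
  have hℓlow : h / (1 + h) ≤ ℓ := by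
    rw [hℓ, hyx]
    have := Real.one_sub_inv_le_log_of_pos (by positivity : (0 : ℝ) < 1 + h)
    rwa [show 1 - (1 + h)⁻¹ = h / (1 + h) by field_simp; ring] at this
  have hℓlow' : h / 2 ≤ ℓ := by
    refine le_trans ?_ hℓlow
    exact div_le_div_of_nonneg_left hh0.le (by positivity) (by linarith)
  have hℓ0 : 0 < ℓ := lt_of_lt_of_le (by positivity) hℓlow'
  -- the three analytic inputs at `x` and `y`
  have hRx : |(∑ n ∈ Icc 1 ⌊x⌋₊, a n / n * Real.log (x / n)) - L| ≤ C * E := hR x hx1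
  have hRy : |(∑ n ∈ Icc 1 ⌊y⌋₊, a n / n * Real.log (y / n)) - L| ≤ C * E := by
    refine (hR y (hx1.trans hxy)).trans ?_
    rw [hE]
    refine mul_le_mul_of_nonneg_left (Real.exp_le_exp.mpr ?_) hC
    exact neg_le_neg (mul_le_mul_of_nonneg_left
      (Real.sqrt_le_sqrt (Real.log_le_log hx0 hxy)) hc.le)
  have hT : |∑ n ∈ Ioc ⌊x⌋₊ ⌊y⌋₊, a n / n * Real.log (y / n)| ≤
      ℓ / x * (A₁ * (y - x) + A₂ * y ^ θ) :=
    (MoebiusRootCount.abs_tail_le a hx0 hxy).trans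
      (mul_le_mul_of_nonneg_left (hS x y hx1 hxy) (by positivity))
  have hid := MoebiusRootCount.logRieszSum_sub_eq a hx0 hxy
  -- `ℓ |M| ≤ 2 C E + (ℓ/x)(A₁ (y-x) + A₂ y^θ)`
  set M : ℝ := ∑ n ∈ Icc 1 ⌊x⌋₊, a n / n with hM
  have hmain : ℓ * |M| ≤ 2 * (C * E) + ℓ / x * (A₁ * (y - x) + A₂ * y ^ θ) := by
    have e : ℓ * M = ((∑ n ∈ Icc 1 ⌊y⌋₊, a n / n * Real.log (y / n)) - L) -
        ((∑ n ∈ Icc 1 ⌊x⌋₊, a n / n * Real.log (x / n)) - L) -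
        ∑ n ∈ Ioc ⌊x⌋₊ ⌊y⌋₊, a n / n * Real.log (y / n) := by
      rw [hM]; linarith
    have habs : ℓ * |M| = |((∑ n ∈ Icc 1 ⌊y⌋₊, a n / n * Real.log (y / n)) - L) -
        ((∑ n ∈ Icc 1 ⌊x⌋₊, a n / n * Real.log (x / n)) - L) -
        ∑ n ∈ Ioc ⌊x⌋₊ ⌊y⌋₊, a n / n * Real.log (y / n)| := by
      rw [← e, abs_mul, abs_of_pos hℓ0]
    have h1 := abs_sub (((∑ n ∈ Icc 1 ⌊y⌋₊, a n / n * Real.log (y / n)) - L) -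
        ((∑ n ∈ Icc 1 ⌊x⌋₊, a n / n * Real.log (x / n)) - L))
        (∑ n ∈ Ioc ⌊x⌋₊ ⌊y⌋₊, a n / n * Real.log (y / n))
    have h2 := abs_sub ((∑ n ∈ Icc 1 ⌊y⌋₊, a n / n * Real.log (y / n)) - L)
        ((∑ n ∈ Icc 1 ⌊x⌋₊, a n / n * Real.log (x / n)) - L)
    rw [habs]
    linarith
  -- divide by `ℓ`
  have hM1 : |M| ≤ 2 * (C * E) / ℓ + (A₁ * h + A₂ * (y ^ θ / x)) := by
    have e2 : ℓ / x * (A₁ * (y - x) + A₂ * y ^ θ) = ℓ * (A₁ * h + A₂ * (y ^ θ / x)) := by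
      rw [hy]; field_simp; ring
    rw [e2] at hmain
    have : |M| ≤ (2 * (C * E) + ℓ * (A₁ * h + A₂ * (y ^ θ / x))) / ℓ := by
      rw [le_div_iff₀ hℓ0]; linarith
    rwa [add_div, mul_div_cancel_left₀ _ hℓ0.ne'] at this
  -- the exponential term: `2CE/ℓ ≤ 2CE/(h/2) = 4 C h`
  have hb1 : 2 * (C * E) / ℓ ≤ 4 * C * h := by
    calc 2 * (C * E) / ℓ ≤ 2 * (C * E) / (h / 2) :=
          div_le_div_of_nonneg_left (by positivity) (by positivity) hℓlow'
      _ = 4 * C * h := by rw [hEh]; field_simp; ring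
  -- the power-saving term: `y^θ/x ≤ 2 x^{θ-1} ≤ 2 K h`
  set K : ℝ := Real.exp (c ^ 2 / (16 * (1 - θ))) with hK
  have hb3 : A₂ * (y ^ θ / x) ≤ 2 * A₂ * K * h := by
    have hyθ : y ^ θ / x = (1 + h) ^ θ * x ^ (θ - 1) := by
      rw [hy, Real.mul_rpow hx0.le (by positivity), Real.rpow_sub_one hx0.ne']; ring
    have h1h : (1 + h) ^ θ ≤ 1 + h := by
      have := Real.rpow_le_rpow_of_exponent_le (by linarith : (1 : ℝ) ≤ 1 + h) hθ.le
      rwa [Real.rpow_one] at this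
    have hxθ : x ^ (θ - 1) ≤ K * h := rpow_sub_one_le_exp_mul_exp c hθ hx1
    calc A₂ * (y ^ θ / x) = A₂ * ((1 + h) ^ θ * x ^ (θ - 1)) := by rw [hyθ]
      _ ≤ A₂ * (2 * (K * h)) := by
          refine mul_le_mul_of_nonneg_left ?_ hA₂
          exact mul_le_mul (h1h.trans (by linarith)) hxθ (by positivity) (by positivity)
      _ = 2 * A₂ * K * h := by ring
  -- conclusion
  calc |M| ≤ 2 * (C * E) / ℓ + (A₁ * h + A₂ * (y ^ θ / x)) := hM1
    _ ≤ 4 * C * h + (A₁ * h + 2 * A₂ * K * h) := by linarith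
    _ = (4 * C + A₁ + 2 * A₂ * K) * h := by ring

/-- `u^A · e^{-c√u} ≤ (2A)!/c^{2A}` for `u ≥ 0`, `c > 0`. [folklore] -/
private theorem pow_mul_exp_neg_sqrt_le {c : ℝ} (hc : 0 < c) (A : ℕ) {u : ℝ} (hu : 0 ≤ u) :
    u ^ A * Real.exp (-(c * Real.sqrt u)) ≤ (Nat.factorial (2 * A) : ℝ) / c ^ (2 * A) := by
  have h := Real.pow_div_factorial_le_exp (c * Real.sqrt u) (by positivity) (2 * A)
  rw [div_le_iff₀ (by positivity)] at h
  rw [le_div_iff₀ (by positivity), Real.exp_neg]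
  have hE : 0 < Real.exp (c * Real.sqrt u) := Real.exp_pos _
  have h2A : Real.sqrt u ^ (2 * A) = u ^ A := by
    rw [pow_mul, Real.sq_sqrt hu]
  calc u ^ A * (Real.exp (c * Real.sqrt u))⁻¹ * c ^ (2 * A)
        = (c * Real.sqrt u) ^ (2 * A) / Real.exp (c * Real.sqrt u) := by
          rw [mul_pow, h2A, div_eq_mul_inv]; ring
    _ ≤ (Nat.factorial (2 * A) : ℝ) := by
          rw [div_le_iff₀ hE]; linarith

end MoebiusRootCount

/-- **Landau's prime ideal theorem for `∑ μ(n)ρ_g(n)/n` in `M`-function (sharp cut-off) form, de la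
Vallée-Poussin rate.**  For `g ∈ ℤ[X]` irreducible of positive degree there are `c > 0` and `C` with
`|∑_{n ≤ x} μ(n)ρ_g(n)/n| ≤ C·exp(−c√(log x))` for all real `x ≥ 1`.  (From the tree's log-Riesz form with
de la Vallée-Poussin rate by differencing over `[x, x(1 + e^{−(c/2)√log x})]`, the short-interval mass being
controlled by the Weber–Landau ideal count.) [cite: LandauMathAnn1903, Part II] -/
theorem abs_sum_moebius_rootCount_div_le_exp {g : ℤ[X]} (hirr : Irreducible g)
    (hdeg : 0 < g.natDegree) :
    ∃ c : ℝ, 0 < c ∧ ∃ C : ℝ, 0 ≤ C ∧ ∀ x : ℝ, 1 ≤ x →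
      |∑ n ∈ Icc 1 ⌊x⌋₊, (ArithmeticFunction.moebius n : ℝ) * (polyRootCountMod ![g] n : ℝ) / n| ≤
        C * Real.exp (-c * Real.sqrt (Real.log x)) := by
  obtain ⟨L, c, hc, C, hR⟩ := abs_logRieszMean_moebius_rootCount_sub_le hirr hdeg
  obtain ⟨A₁, A₂, θ, hA₁, hA₂, hθ1, hS⟩ :=
    MoebiusRootCount.shortInterval_abs_moebius_mul_rootCount_le hirr hdeg
  have hC0 : 0 ≤ C := by
    have h := (abs_nonneg _).trans (hR 1 le_rfl)
    rw [Real.log_one, Real.sqrt_zero, mul_zero, Real.exp_zero, mul_one] at h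
    exact h
  set a : ℕ → ℝ := fun n => (ArithmeticFunction.moebius n : ℝ) * (polyRootCountMod ![g] n : ℝ)
    with ha
  have hR' : ∀ x : ℝ, 1 ≤ x →
      |(∑ n ∈ Icc 1 ⌊x⌋₊, a n / n * Real.log (x / n)) - L| ≤
        C * Real.exp (-(c * Real.sqrt (Real.log x))) := by
    intro x hx
    have := hR x hx
    rwa [neg_mul] at this
  have key := MoebiusRootCount.abs_cutoff_le_of_logRiesz_of_shortInterval a hc hC0 hA₂ hθ1 hR' hS
  refine ⟨c / 2, by positivity, 4 * C + A₁ + 2 * A₂ * Real.exp (c ^ 2 / (16 * (1 - θ))),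
    by positivity, fun x hx => ?_⟩
  have h := key x hx
  rwa [neg_mul] at h ⊢

/-- **Log-power form, every exponent.**  For `g ∈ ℤ[X]` irreducible of positive degree and every `A : ℕ` there
is `C_A` with `|∑_{n ≤ x} μ(n)ρ_g(n)/n| ≤ C_A/(log x)^A` for all real `x ≥ 2`. [cite: LandauMathAnn1903, Part II] -/
theorem abs_sum_moebius_rootCount_div_le_log_pow {g : ℤ[X]} (hirr : Irreducible g)
    (hdeg : 0 < g.natDegree) (A : ℕ) :
    ∃ C : ℝ, ∀ x : ℝ, 2 ≤ x →
      |∑ n ∈ Icc 1 ⌊x⌋₊, (ArithmeticFunction.moebius n : ℝ) * (polyRootCountMod ![g] n : ℝ) / n| ≤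
        C / Real.log x ^ A := by
  obtain ⟨c, hc, C, hC0, h⟩ := abs_sum_moebius_rootCount_div_le_exp hirr hdeg
  refine ⟨C * ((Nat.factorial (2 * A) : ℝ) / c ^ (2 * A)), fun x hx => ?_⟩
  have hx1 : (1 : ℝ) ≤ x := by linarith
  have hl0 : 0 < Real.log x := Real.log_pos (by linarith)
  have hb := MoebiusRootCount.pow_mul_exp_neg_sqrt_le hc A hl0.le
  rw [le_div_iff₀ (pow_pos hl0 A)]
  calc |∑ n ∈ Icc 1 ⌊x⌋₊, (ArithmeticFunction.moebius n : ℝ) * (polyRootCountMod ![g] n : ℝ) / n|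
        * Real.log x ^ A
        ≤ C * Real.exp (-c * Real.sqrt (Real.log x)) * Real.log x ^ A :=
          mul_le_mul_of_nonneg_right (h x hx1) (pow_nonneg hl0.le A)
    _ = C * (Real.log x ^ A * Real.exp (-(c * Real.sqrt (Real.log x)))) := by rw [neg_mul]; ring
    _ ≤ C * ((Nat.factorial (2 * A) : ℝ) / c ^ (2 * A)) := mul_le_mul_of_nonneg_left hb hC0

end Literature.NumberTheory.LFunctions
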